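import Summits.Ventures.HodgeRepro2.NonVanishingSelfAdjointHodgePeriod
import Summits.Ventures.HodgeRepro2.AtkinLehnerEigenvalues
import Summits.Ventures.HodgeRepro2.LevelNormalizer

/-!
# AtkinLehnerPeriod — the (N)-period partner of the vertex form under a NORMALISING involution has Atkin–Lehner
sign `±1` (p2 annex row 164; re-creation of gen 17's unlanded «AtkinLehnerPeriod» of KERNEL-INDEX v6)

Cell pub-hodge-repro2, Tier 5 kernel annex (seat p2, Shimura-data / Hecke side). Proof lane (no new definition).
§8(d): uses an L-value-free non-vanishing device: NO.

* `mk_ne_zero_of_setIntegral_hodgeWedge_ne_zero` — `∫_D ω_f ∧ conj ω_g ≠ 0 ⇒ [g] ≠ 0` in the Petersson space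
  (the bridge `∫_D ω_f ∧ conj ω_g = 4 ⟪[g], [f]⟫` of row 124).
* `NonVanishingInput.exists_hecke_eigenform_hodgePeriod_ne_zero_of_mul_self_eq_one'` — row 141's closing
  statement for every involution `δ ∈ U(H)(K)` (`δ² = 1 ⇒ δ⁻¹ ∈ S'δS'`, row 147), with the eigenform's class
  non-zero.
* `NonVanishingInput.exists_atkinLehner_eigenform_hodgePeriod_ne_zero` — THE ATKIN–LEHNER SIGN: the Tier-3
  input gives a torsion-free congruence `S' ⊆ Γ_N` of finite index in `Γ₁` with compact quotient, a fundamental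
  domain `D` and a vertex form `f ≢ 0` such that for EVERY involution `δ ∈ U(H)(K)` NORMALISING `S'` there is a
  holomorphic weight-3 form `g` with `T_δ [g] = [g]` or `T_δ [g] = −[g]` and `∫_D ω_f ∧ conj ω_g ≠ 0` (row 148's
  `±1` eigenvalues of a normalising involution applied to the real-eigenvalue partner of row 141).

No `sorry`; `#print axioms` ⊆ {propext, Classical.choice, Quot.sound}.
-/

namespace Summit.Ventures.HodgeRepro2.ShimuraData

variable {K : Type*} [Field K] [NumberField K] [NumberField.IsCMField K]
  {τ₁ : K →+* ℂ} {H : Matrix (Fin 3) (Fin 3) K} {Q : Matrix (Fin 3) (Fin 3) ℂ}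

/-- A non-zero Hodge period `∫_D ω_f ∧ conj ω_g ≠ 0` forces `[g] ≠ 0` in the Petersson space. -/
theorem mk_ne_zero_of_setIntegral_hodgeWedge_ne_zero (hQ : IsFrame K τ₁ H Q) (S : Subgroup (GL (Fin 3) K))
    (hS : (S : Set (GL (Fin 3) K)) ⊆ unitaryGroup K H) [CompactSpace (ballQuotient hQ S hS)] {D : Set ball₂}
    (hD : IsBallFundamentalDomain hQ S hS D) (hDm : MeasurableSet D) {f g : PeterssonForms hQ S hS 3 hD}
    (h : ∫ x in (Subtype.val '' D),
      hodgeWedge (PeterssonForms.toForm hQ S hS 3 hD f : (Fin 2 → ℂ) → ℂ)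
        (PeterssonForms.toForm hQ S hS 3 hD g : (Fin 2 → ℂ) → ℂ) x ≠ 0) :
    SeparationQuotient.mk g ≠ 0 := by
  intro hg
  apply h
  rw [setIntegral_hodgeWedge_eq_inner_mk hQ S hS hD hDm, hg, inner_zero_left, mul_zero]

/-- Row 141's closing statement for every INVOLUTION `δ ∈ U(H)(K)` (`δ² = 1 ⇒ δ⁻¹ ∈ S'δS'`), the partner's class
non-zero. -/
theorem NonVanishingInput.exists_hecke_eigenform_hodgePeriod_ne_zero_of_mul_self_eq_one'
    {𝔪 : Submodule ℤ (Fin 3 → K)} (hH : IsHermitianForm K H)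
    (hdef : ∀ τ : K →+* ℂ, NumberField.InfinitePlace.mk τ ≠ NumberField.InfinitePlace.mk τ₁ →
      IsDefiniteAt K τ H)
    (hQ : IsFrame K τ₁ H Q) (h𝔪 : IsLattice K 𝔪) (hnv : NonVanishingInput K τ₁ H 𝔪 Q)
    {N : ℕ} (hN : 2 < N)
    [CompactSpace (ballQuotient hQ (shimuraLevelSubgroup K H 𝔪 1)
      (shimuraLevelSubgroup_one_subset_unitaryGroup H 𝔪))] :
    ∃ S' : Subgroup (GL (Fin 3) K), ∃ hS' : (S' : Set (GL (Fin 3) K)) ⊆ shimuraLevel K H 𝔪 N,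
      IsTorsionFreeSet K (S' : Set (GL (Fin 3) K)) ∧
      ∃ (hS₁ : S' ≤ shimuraLevelSubgroup K H 𝔪 1)
        (hfin : (S'.subgroupOf (shimuraLevelSubgroup K H 𝔪 1)).FiniteIndex)
        (_hc : CompactSpace (ballQuotient hQ S'
          (hS'.trans (shimuraLevelSubgroup_subset_unitaryGroup H 𝔪 N)))),
      ∃ D : Set ball₂, ∃ (hDm : MeasurableSet D)
        (hD : IsBallFundamentalDomain hQ S' (hS'.trans (shimuraLevelSubgroup_subset_unitaryGroup H 𝔪 N)) D),
      ∃ f ∈ holomorphicForms hQ S' (hS'.trans (shimuraLevelSubgroup_subset_unitaryGroup H 𝔪 N)) 3 hD,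
        SeparationQuotient.mk f ≠ 0 ∧
        ∀ δ : unitaryGroup K H, (δ : GL (Fin 3) K) * δ = 1 →
          ∃ g ∈ holomorphicForms hQ S' (hS'.trans (shimuraLevelSubgroup_subset_unitaryGroup H 𝔪 N)) 3 hD,
            SeparationQuotient.mk g ≠ 0 ∧
            (∃ r : ℝ, heckeFamilyOf hQ S' (hS'.trans (shimuraLevelSubgroup_subset_unitaryGroup H 𝔪 N)) 3 hD
                hDm (fun δ => fintypeHeckeQuotientOfFiniteIndex h𝔪 hS₁ hfin δ.2) δ
                (SeparationQuotient.mk g) = (r : ℂ) • SeparationQuotient.mk g) ∧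
            ∫ x in (Subtype.val '' D),
              hodgeWedge
                (PeterssonForms.toForm hQ S' (hS'.trans (shimuraLevelSubgroup_subset_unitaryGroup H 𝔪 N))
                  3 hD f : (Fin 2 → ℂ) → ℂ)
                (PeterssonForms.toForm hQ S' (hS'.trans (shimuraLevelSubgroup_subset_unitaryGroup H 𝔪 N))
                  3 hD g : (Fin 2 → ℂ) → ℂ) x ≠ 0 := by
  obtain ⟨S', hS', htf, hS₁, hfin, hc, D, hDm, hD, f, hf, hf0, hδ⟩ :=
    NonVanishingInput.exists_hecke_eigenform_hodgePeriod_ne_zero hH hdef hQ h𝔪 hnv hN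
  refine ⟨S', hS', htf, hS₁, hfin, hc, D, hDm, hD, f, hf, hf0, fun δ hδ2 => ?_⟩
  obtain ⟨g, hg, hr, hper⟩ := hδ δ (inv_mem_doubleCoset_of_sq_mem (by rw [hδ2]; exact S'.one_mem))
  exact ⟨g, hg, mk_ne_zero_of_setIntegral_hodgeWedge_ne_zero hQ S' _ hD hDm hper, hr, hper⟩

/-- THE ATKIN–LEHNER SIGN OF THE (N)-PERIOD PARTNER: for every involution `δ ∈ U(H)(K)` NORMALISING the
congruence group `S'` produced by the Tier-3 input, the real-eigenvalue partner `g` of the vertex form has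
`T_δ [g] = [g]` or `T_δ [g] = −[g]` (row 148), with `∫_D ω_f ∧ conj ω_g ≠ 0`. -/
theorem NonVanishingInput.exists_atkinLehner_eigenform_hodgePeriod_ne_zero
    {𝔪 : Submodule ℤ (Fin 3 → K)} (hH : IsHermitianForm K H)
    (hdef : ∀ τ : K →+* ℂ, NumberField.InfinitePlace.mk τ ≠ NumberField.InfinitePlace.mk τ₁ →
      IsDefiniteAt K τ H)
    (hQ : IsFrame K τ₁ H Q) (h𝔪 : IsLattice K 𝔪) (hnv : NonVanishingInput K τ₁ H 𝔪 Q)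
    {N : ℕ} (hN : 2 < N)
    [CompactSpace (ballQuotient hQ (shimuraLevelSubgroup K H 𝔪 1)
      (shimuraLevelSubgroup_one_subset_unitaryGroup H 𝔪))] :
    ∃ S' : Subgroup (GL (Fin 3) K), ∃ hS' : (S' : Set (GL (Fin 3) K)) ⊆ shimuraLevel K H 𝔪 N,
      IsTorsionFreeSet K (S' : Set (GL (Fin 3) K)) ∧
      ∃ (hS₁ : S' ≤ shimuraLevelSubgroup K H 𝔪 1)
        (hfin : (S'.subgroupOf (shimuraLevelSubgroup K H 𝔪 1)).FiniteIndex)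
        (_hc : CompactSpace (ballQuotient hQ S'
          (hS'.trans (shimuraLevelSubgroup_subset_unitaryGroup H 𝔪 N)))),
      ∃ D : Set ball₂, ∃ (hDm : MeasurableSet D)
        (hD : IsBallFundamentalDomain hQ S' (hS'.trans (shimuraLevelSubgroup_subset_unitaryGroup H 𝔪 N)) D),
      ∃ f ∈ holomorphicForms hQ S' (hS'.trans (shimuraLevelSubgroup_subset_unitaryGroup H 𝔪 N)) 3 hD,
        SeparationQuotient.mk f ≠ 0 ∧
        ∀ δ : unitaryGroup K H, (δ : GL (Fin 3) K) * δ = 1 →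
          (∀ s : GL (Fin 3) K, s ∈ S' ↔ (δ : GL (Fin 3) K) * s * (δ : GL (Fin 3) K)⁻¹ ∈ S') →
          ∃ g ∈ holomorphicForms hQ S' (hS'.trans (shimuraLevelSubgroup_subset_unitaryGroup H 𝔪 N)) 3 hD,
            SeparationQuotient.mk g ≠ 0 ∧
            (heckeFamilyOf hQ S' (hS'.trans (shimuraLevelSubgroup_subset_unitaryGroup H 𝔪 N)) 3 hD
                hDm (fun δ => fintypeHeckeQuotientOfFiniteIndex h𝔪 hS₁ hfin δ.2) δ
                (SeparationQuotient.mk g) = SeparationQuotient.mk g ∨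
              heckeFamilyOf hQ S' (hS'.trans (shimuraLevelSubgroup_subset_unitaryGroup H 𝔪 N)) 3 hD
                hDm (fun δ => fintypeHeckeQuotientOfFiniteIndex h𝔪 hS₁ hfin δ.2) δ
                (SeparationQuotient.mk g) = -SeparationQuotient.mk g) ∧
            ∫ x in (Subtype.val '' D),
              hodgeWedge
                (PeterssonForms.toForm hQ S' (hS'.trans (shimuraLevelSubgroup_subset_unitaryGroup H 𝔪 N))
                  3 hD f : (Fin 2 → ℂ) → ℂ)
                (PeterssonForms.toForm hQ S' (hS'.trans (shimuraLevelSubgroup_subset_unitaryGroup H 𝔪 N))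
                  3 hD g : (Fin 2 → ℂ) → ℂ) x ≠ 0 := by
  obtain ⟨S', hS', htf, hS₁, hfin, hc, D, hDm, hD, f, hf, hf0, hδ⟩ :=
    NonVanishingInput.exists_hecke_eigenform_hodgePeriod_ne_zero_of_mul_self_eq_one' hH hdef hQ h𝔪 hnv hN
  refine ⟨S', hS', htf, hS₁, hfin, hc, D, hDm, hD, f, hf, hf0, fun δ hδ2 hnorm => ?_⟩
  obtain ⟨g, hg, hg0, ⟨r, hr⟩, hper⟩ := hδ δ hδ2
  refine ⟨g, hg, hg0, ?_, hper⟩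
  rcases heckeFamilyOf_eigenvalue_eq_one_or_neg_one_of_normalizes_of_sq_eq_one hQ S' _ 3 hD hDm _ hnorm hδ2
      hg0 hr with h1 | h1
  · left; rw [hr, h1, one_smul]
  · right; rw [hr, h1, neg_one_smul]

end Summit.Ventures.HodgeRepro2.ShimuraData
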